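import Summits.HodgeConjecture.HodgeConjecture.Theorems.Ring2WeilCoverageWeilGramCMPoint
import Summits.HodgeConjecture.HodgeConjecture.Theorems.Ring2WeilCoverageCMTypeSignParity
import Summits.HodgeConjecture.HodgeConjecture.Theorems.Ring2WeilCoverageCMUnitSignature
import HarnessLib

/-!
# Weil-type family coverage — THE SIGN OF `det H` AT A CM POINT: van Geemen's Lemma 5.2 (4) «`(−1)ⁿ det H > 0`»
# DERIVED for the Gram datum of part 82, and its contrapositive (a wrong-signed type carries no polarisation on a
# Weil-type CM type)

research route conditional on HC_CM; not a corollary; Q11.4-sentence-2 already refuted in dim ≥ 3.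

Ring 2, WEIL-TYPE FAMILY-COVERAGE CENSUS (`HOME/WEIL-FAMILY-COVERAGE.md` `## b01`, block b01.41 (C)(i) «SIGN CHECK,
kernel-independent: on all nine NO rows the principal `ξ` gives `a = −1` … the NO verdict re-derived from determinants»
— S-pencil there; owner ring2-b01), part 92 of the `Ring2WeilCoverage*` series; completes part 82
(`Ring2WeilCoverageWeilGramCMPoint`: `det a = (−2)^g N_{K⁺/ℚ}(γ₀) disc(ω)`, `γ₀ = ζ′s`).

* §1 **`discr_pos_of_isTotallyReal`: the discriminant of a `ℚ`-basis of a TOTALLY REAL number field is POSITIVE**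
  (`disc = det(σᵢ ωⱼ)²` with all `σᵢ ωⱼ` real — Mathlib `Algebra.discr_eq_det_embeddingsMatrixReindex_pow_two` in `ℂ`
  plus `IsTotallyReal.complexEmbedding_isReal`).
* §2 `re_embedding_skew_mul_skew`: `Re (ζ′s)^φ = −Im ζ′^φ · Im s^φ` for skew `ζ′, s`; hence for a `Φ`-POSITIVE `ζ′`
  (`Im ζ′^φ > 0` on `Φ`): `Re γ^φ < 0 ↔ 0 < Im s^φ` (`γ = ζ′s`), and the norm sign
  **`norm_pos_iff_even_card`: `0 < N_{K⁺/ℚ}(γ₀) ↔ #{φ ∈ Φ : 0 < Im s^φ}` even** (parts 2/55: `∏_{φ∈Φ} Re γ^φ = N(γ₀)`).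
* §3 **THE SIGN LAW `det_realPart_pos_iff`: for a `Φ`-positive `ζ′` and a `ℚ`-basis frame `ω` of `K⁺`,
  `0 < det a ↔ Even (g + #{φ ∈ Φ : 0 < Im s^φ})`** — i.e. `sign(det a) = (−1)^q`, `q = #{φ ∈ Φ : Im s^φ < 0}` — and
  the WEIL FORM **`neg_one_pow_mul_det_realPart_pos`: if `Φ` has `s`-signature `(n, n)`
  (`#{Im s^φ < 0} = #{0 < Im s^φ} = n`, `g = 2n`) then `0 < (−1)ⁿ det a`** = [vG94 Lemma 5.2 (4)] «the signature of `H`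
  is `(n, n)`», in its determinant form, DERIVED at CM points; contrapositive **`not_pos_of_sign`: if `(−1)ⁿ det a ≤ 0`
  for the Gram datum of `(E_ζ′, s)` then `ζ′` is not `Φ`-positive for any `Φ` of `s`-signature `(n, n)`** — the census's
  NO rows read from a determinant SIGN (parts 83/85: `det a = −144`, `−3600 < 0` for every principal-type `ζ′` on
  `ℤ[ζ₁₅]`, so no principal `ι`-compatible polarisation on a Weil-type `ℤ[ζ₁₅]`-fourfold — consistent with part 75).

HONEST FRAMING as part 82: statements about the rational matrix `a` attached to `(ζ′, s, ω)` and about embeddings; by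
part 82 §5 `a` is the Gram datum of Shimura's `E_ζ′` on `ℂ^Φ`; the statement «signature `(n, n)`» itself is only used in
its determinant-sign form; nothing about Hodge classes, `W_K`, general members or HC; `HC_CM` is used nowhere.  No `def`,
no named fact, no `sorry`.

References: [cite: vanGeemen1994HodgeAV, Lemma 5.2 (2)–(4)]; [cite: Shimura1998, §6.2 Thm. 4 and §14.2 Prop. 2, pp. 44–45,
102]; census b01.41 (C)(i) (seat-derived).
-/

noncomputable section

open Polynomial Module NumberField
open scoped nonZeroDivisors ComplexConjugate

namespace Summit.HodgeConjecture.Ring2WeilCoverage.WeilGramSign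

open Literature.AlgebraicGeometry.Motives (CMType)
open Literature.NumberTheory.ComplexMultiplication
open Summit.HodgeConjecture.Ring2WeilCoverage.WeilGramCMPoint
open Summit.HodgeConjecture.Ring2WeilCoverage.CMTypeSignParity (prod_pos_iff_even_card_filter_neg
  im_embedding_ne_zero_of_skew re_embedding_ne_zero_of_real)
open Summit.HodgeConjecture.Ring2WeilCoverage.CMUnitSignature (prod_re_embedding_algebraMap_eq_norm
  card_eq_card_embeddings_maximalRealSubfield)

/-! ### §1 The discriminant of a basis of a totally real field is positive -/

/-- **`0 < disc_{F/ℚ}(b)`** for a `ℚ`-basis `b` of a totally real number field `F`: in `ℂ`, `disc = det(σⱼ(bᵢ))²` and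
every `σⱼ(bᵢ)` is real, so `disc` is the square of a non-zero real number.
research route conditional on HC_CM; not a corollary; Q11.4-sentence-2 already refuted in dim ≥ 3. [folklore] -/
theorem discr_pos_of_isTotallyReal {F : Type*} [Field F] [NumberField F] [IsTotallyReal F] {ι : Type*} [Fintype ι]
    [DecidableEq ι] (b : Basis ι ℚ F) : 0 < Algebra.discr ℚ b := by
  classical
  have hcard : Fintype.card ι = Fintype.card (F →ₐ[ℚ] ℂ) := by
    rw [AlgHom.card ℚ F ℂ, Module.finrank_eq_card_basis b]
  let e : ι ≃ (F →ₐ[ℚ] ℂ) := Fintype.equivOfCardEq hcard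
  set M := Algebra.embeddingsMatrixReindex ℚ ℂ b e with hM
  have h := Algebra.discr_eq_det_embeddingsMatrixReindex_pow_two ℚ ℂ b e
  have hentry : ∀ i j, conj (M i j) = M i j := by
    intro i j
    have hr := IsTotallyReal.complexEmbedding_isReal ((e j).toRingHom)
    rw [ComplexEmbedding.isReal_iff] at hr
    have hx := RingHom.congr_fun hr (b i)
    rw [ComplexEmbedding.conjugate_coe_eq] at hx
    simpa [hM, Algebra.embeddingsMatrixReindex, Algebra.embeddingsMatrix] using hx
  have hdet : conj M.det = M.det := by
    rw [show conj M.det = (M.map conj).det from by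
      rw [← RingHom.mapMatrix_apply]; exact RingHom.map_det (starRingEnd ℂ) M]
    congr 1
    ext i j
    exact hentry i j
  have hre : ((M.det.re : ℝ) : ℂ) = M.det := Complex.conj_eq_iff_re.mp hdet
  have hne : Algebra.discr ℚ b ≠ 0 := Algebra.discr_not_zero_of_basis ℚ b
  have hR : ((Algebra.discr ℚ b : ℚ) : ℝ) = M.det.re ^ 2 := by
    apply Complex.ofReal_injective
    rw [Complex.ofReal_pow, hre, ← h, Complex.ofReal_ratCast]
    rfl
  have hpos : (0 : ℝ) < ((Algebra.discr ℚ b : ℚ) : ℝ) := by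
    rw [hR]
    rcases (sq_nonneg M.det.re).lt_or_eq with hlt | heq
    · exact hlt
    · exfalso
      apply hne
      have : ((Algebra.discr ℚ b : ℚ) : ℝ) = 0 := by rw [hR, ← heq]
      exact_mod_cast this
  exact_mod_cast hpos

/-! ### §2 Signs at the embeddings: `Re (ζ′s)^φ = −Im ζ′^φ · Im s^φ` -/

variable {K : Type} [Field K] [NumberField K] [IsCMField K]

/-- `Re (ζ′s)^φ = −Im ζ′^φ · Im s^φ` for skew `ζ′`, `s` (both `φ`-values are purely imaginary).
research route conditional on HC_CM; not a corollary; Q11.4-sentence-2 already refuted in dim ≥ 3. [cite: Shimura1998, §14.2 Prop. 2, p. 102] -/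
theorem re_embedding_skew_mul_skew {ζ' s : K} (hζ' : IsCMField.complexConj K ζ' = -ζ')
    (hs : IsCMField.complexConj K s = -s) (φ : K →+* ℂ) :
    (φ (ζ' * s)).re = -((φ ζ').im * (φ s).im) := by
  rw [map_mul, Complex.mul_re, CMTypeLattice.re_embedding_eq_zero_of_skew hζ' φ,
    CMTypeLattice.re_embedding_eq_zero_of_skew hs φ]
  ring

/-- For a `Φ`-positive `ζ′`: `Re (ζ′s)^φ < 0 ↔ 0 < Im s^φ` at `φ ∈ Φ`.
research route conditional on HC_CM; not a corollary; Q11.4-sentence-2 already refuted in dim ≥ 3. [cite: Shimura1998, §14.2 Prop. 2, p. 102] -/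
theorem re_embedding_neg_iff {ζ' s : K} (hζ' : IsCMField.complexConj K ζ' = -ζ')
    (hs : IsCMField.complexConj K s = -s) {φ : K →+* ℂ} (hpos : 0 < (φ ζ').im) :
    (φ (ζ' * s)).re < 0 ↔ 0 < (φ s).im := by
  rw [re_embedding_skew_mul_skew hζ' hs φ, neg_lt_zero]
  constructor
  · intro h
    by_contra hle
    push Not at hle
    nlinarith [mul_nonneg hpos.le (neg_nonneg.mpr hle)]
  · intro h
    exact mul_pos hpos h

/-! ### §3 The sign law for `det a` and van Geemen's `(−1)ⁿ det H > 0` at CM points -/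

section SignLaw

variable (Φ : CMType K) {m : ℕ} {ζ' s : K} {x : Fin m → K} {γ₀ : maximalRealSubfield K}
  {a : Matrix (Fin m) (Fin m) ℚ}

open scoped Classical in
/-- For a `Φ`-positive `ζ′`: `#{φ ∈ Φ : Re (ζ′s)^φ < 0} = #{φ ∈ Φ : 0 < Im s^φ}`.
research route conditional on HC_CM; not a corollary; Q11.4-sentence-2 already refuted in dim ≥ 3. [cite: Shimura1998, §14.2 Prop. 2, p. 102] -/
theorem card_filter_re_neg_eq (hζ' : IsCMField.complexConj K ζ' = -ζ') (hs : IsCMField.complexConj K s = -s)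
    (hpos : ∀ φ : Φ.1, 0 < (φ.1 ζ').im) :
    (Finset.univ.filter fun φ : Φ.1 => (φ.1 (ζ' * s)).re < 0).card =
      (Finset.univ.filter fun φ : Φ.1 => 0 < (φ.1 s).im).card := by
  congr 1
  exact Finset.filter_congr fun φ _ => re_embedding_neg_iff hζ' hs (hpos φ)

open scoped Classical in
/-- **The norm sign: `0 < N_{K⁺/ℚ}(γ₀) ↔ #{φ ∈ Φ : 0 < Im s^φ}` is even** for `γ₀ = ζ′s` with `ζ′` `Φ`-positive
(`∏_{φ∈Φ} Re γ^φ = N(γ₀)`, part 2; `Re γ^φ < 0 ↔ 0 < Im s^φ`).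
research route conditional on HC_CM; not a corollary; Q11.4-sentence-2 already refuted in dim ≥ 3. [cite: Shimura1998, §14.2 Prop. 2, p. 102] -/
theorem norm_pos_iff_even_card (hζ' : IsCMField.complexConj K ζ' = -ζ') (hs : IsCMField.complexConj K s = -s)
    (hs0 : s ≠ 0) (hζ'0 : ζ' ≠ 0) (hpos : ∀ φ : Φ.1, 0 < (φ.1 ζ').im) (hγ : (γ₀ : K) = ζ' * s) :
    0 < Algebra.norm ℚ γ₀ ↔ Even (Finset.univ.filter fun φ : Φ.1 => 0 < (φ.1 s).im).card := by
  have hreal : IsCMField.complexConj K (ζ' * s) = ζ' * s := by rw [map_mul, hζ', hs, neg_mul_neg]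
  have hne : ζ' * s ≠ 0 := mul_ne_zero hζ'0 hs0
  have hprod := prod_re_embedding_algebraMap_eq_norm Φ γ₀
  rw [show algebraMap (maximalRealSubfield K) K γ₀ = (γ₀ : K) from rfl, hγ] at hprod
  rw [← card_filter_re_neg_eq Φ hζ' hs hpos,
    ← prod_pos_iff_even_card_filter_neg _ _ (fun φ _ => re_embedding_ne_zero_of_real hreal hne φ.1), hprod]
  exact_mod_cast Iff.rfl

open scoped Classical in
/-- **THE SIGN LAW: `0 < det a ↔ Even (g + #{φ ∈ Φ : 0 < Im s^φ})`** for the Gram datum `a` of `(E_ζ′, s)` in a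
`ℚ`-basis frame `ω` of `K⁺` (`g = [K⁺:ℚ]`), `ζ′` `Φ`-positive: `det a = (−2)^g N(γ₀) disc(ω)` (part 82) with `disc(ω) > 0`
(§1) — so `sign(det a) = (−1)^q`, `q = #{φ ∈ Φ : Im s^φ < 0}`.
research route conditional on HC_CM; not a corollary; Q11.4-sentence-2 already refuted in dim ≥ 3. [cite: vanGeemen1994HodgeAV, Lemma 5.2 (3)–(4)] -/
theorem det_realPart_pos_iff (ωb : Basis (Fin m) ℚ (maximalRealSubfield K)) (hζ' : IsCMField.complexConj K ζ' = -ζ')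
    (hs : IsCMField.complexConj K s = -s) (hs0 : s ≠ 0) (hζ'0 : ζ' ≠ 0) (hpos : ∀ φ : Φ.1, 0 < (φ.1 ζ').im)
    (hx : ∀ i, x i = (ωb i : K)) (hγ : (γ₀ : K) = ζ' * s)
    (ha : ∀ i j, a i j = Algebra.trace ℚ K (ζ' * x i * IsCMField.complexConj K (s * x j))) :
    0 < a.det ↔ Even (m + (Finset.univ.filter fun φ : Φ.1 => 0 < (φ.1 s).im).card) := by
  rw [det_realPart_eq ωb hs hx hγ ha, Nat.even_add, ← norm_pos_iff_even_card Φ hζ' hs hs0 hζ'0 hpos hγ]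
  have hD : 0 < Algebra.discr ℚ ωb := discr_pos_of_isTotallyReal ωb
  have hN : Algebra.norm ℚ γ₀ ≠ 0 := by
    rw [Algebra.norm_ne_zero_iff]
    intro h0
    apply mul_ne_zero hζ'0 hs0
    rw [← hγ, h0]
    rfl
  rw [mul_assoc, show (-2 : ℚ) ^ m = (-1) ^ m * 2 ^ m by rw [← mul_pow]; norm_num, mul_assoc]
  rcases Nat.even_or_odd m with hm | hm
  · rw [hm.neg_one_pow, one_mul]
    simp only [hm, true_iff]
    constructor
    · intro h
      exact pos_of_mul_pos_left ((pos_iff_pos_of_mul_pos h).1 (by positivity)) hD.le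
    · intro h
      positivity
  · rw [hm.neg_one_pow, neg_one_mul, neg_pos]
    have hnot : ¬ Even m := Nat.not_even_iff_odd.mpr hm
    simp only [hnot, false_iff, not_lt]
    constructor
    · intro h
      have h2 : Algebra.norm ℚ γ₀ * Algebra.discr ℚ ωb < 0 := by
        by_contra hc
        push Not at hc
        have : 0 ≤ (2 : ℚ) ^ m * (Algebra.norm ℚ γ₀ * Algebra.discr ℚ ωb) := by positivity
        linarith
      exact (neg_of_mul_neg_left h2 hD.le).le
    · intro h
      have hlt : Algebra.norm ℚ γ₀ < 0 := lt_of_le_of_ne h hN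
      have : Algebra.norm ℚ γ₀ * Algebra.discr ℚ ωb < 0 := mul_neg_of_neg_of_pos hlt hD
      nlinarith [pow_pos (show (0:ℚ) < 2 by norm_num) m]

open scoped Classical in
/-- **VAN GEEMEN'S LEMMA 5.2 (4) AT A CM POINT: `0 < (−1)ⁿ det a`** when `Φ` has `s`-signature `(n, n)`
(`#{φ ∈ Φ : Im s^φ < 0} = #{φ ∈ Φ : 0 < Im s^φ} = n`: the Weil-type condition on the `ℚ(s)`-action) and `ζ′` is
`Φ`-positive (so `E_ζ′` is a polarisation of `ℂ^Φ/D(𝔪)` and `a` the Gram matrix of `H` in a `K_d`-basis, part 82).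
research route conditional on HC_CM; not a corollary; Q11.4-sentence-2 already refuted in dim ≥ 3. [cite: vanGeemen1994HodgeAV, Lemma 5.2 (4)] -/
theorem neg_one_pow_mul_det_realPart_pos (ωb : Basis (Fin m) ℚ (maximalRealSubfield K))
    (hζ' : IsCMField.complexConj K ζ' = -ζ') (hs : IsCMField.complexConj K s = -s) (hs0 : s ≠ 0) (hζ'0 : ζ' ≠ 0)
    (hpos : ∀ φ : Φ.1, 0 < (φ.1 ζ').im) {n : ℕ}
    (hneg : (Finset.univ.filter fun φ : Φ.1 => (φ.1 s).im < 0).card = n)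
    (hposc : (Finset.univ.filter fun φ : Φ.1 => 0 < (φ.1 s).im).card = n)
    (hx : ∀ i, x i = (ωb i : K)) (hγ : (γ₀ : K) = ζ' * s)
    (ha : ∀ i j, a i j = Algebra.trace ℚ K (ζ' * x i * IsCMField.complexConj K (s * x j))) :
    0 < (-1 : ℚ) ^ n * a.det := by
  -- `m = #Φ = n + n`
  have hm : m = n + n := by
    have h1 : Fintype.card Φ.1 = m := by
      rw [card_eq_card_embeddings_maximalRealSubfield Φ, NumberField.Embeddings.card,
        Module.finrank_eq_card_basis ωb, Fintype.card_fin]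
    have h2 := Finset.card_filter_add_card_filter_not
      (s := (Finset.univ : Finset Φ.1)) (fun φ : Φ.1 => 0 < (φ.1 s).im)
    have h3 : (Finset.univ.filter fun φ : Φ.1 => ¬ 0 < (φ.1 s).im) =
        Finset.univ.filter fun φ : Φ.1 => (φ.1 s).im < 0 := by
      refine Finset.filter_congr fun φ _ => ?_
      have hne := im_embedding_ne_zero_of_skew hs hs0 φ.1
      constructor
      · intro h; exact lt_of_le_of_ne (not_lt.mp h) hne
      · intro h; exact not_lt.mpr h.le
    rw [h3, hposc, hneg, Finset.card_univ, h1] at h2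
    omega
  have hiff := det_realPart_pos_iff Φ ωb hζ' hs hs0 hζ'0 hpos hx hγ ha
  rw [hposc] at hiff
  have key : Even (m + n) ↔ Even n := by simp only [Nat.even_iff]; omega
  rw [key] at hiff
  have hdet0 : a.det ≠ 0 := by
    have hγ0 : γ₀ ≠ 0 := by
      intro h0; apply mul_ne_zero hζ'0 hs0; rw [← hγ, h0]; rfl
    exact det_realPart_ne_zero ωb hs hx hγ hγ0 ha
  rcases Nat.even_or_odd n with hn | hn
  · rw [hn.neg_one_pow, one_mul]
    exact hiff.mpr hn
  · rw [hn.neg_one_pow, neg_one_mul, neg_pos]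
    have hnot : ¬ (0 < a.det) := fun h => (Nat.not_even_iff_odd.mpr hn) (hiff.mp h)
    exact lt_of_le_of_ne (not_lt.mp hnot) hdet0

open scoped Classical in
/-- **Contrapositive: a wrong-signed form is not a polarisation on a Weil-type CM type.**  If the Gram datum `a` of
`(E_ζ′, s)` in a `ℚ`-basis frame of `K⁺` has `(−1)ⁿ det a ≤ 0`, then `ζ′` is NOT `Φ`-positive for any CM type `Φ` of
`s`-signature `(n, n)` (census: the NO rows from a determinant SIGN; parts 83/85 at level `15`).
research route conditional on HC_CM; not a corollary; Q11.4-sentence-2 already refuted in dim ≥ 3. [cite: vanGeemen1994HodgeAV, Lemma 5.2 (4)] -/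
theorem not_pos_of_neg_one_pow_mul_det_nonpos (ωb : Basis (Fin m) ℚ (maximalRealSubfield K))
    (hζ' : IsCMField.complexConj K ζ' = -ζ') (hs : IsCMField.complexConj K s = -s) (hs0 : s ≠ 0) (hζ'0 : ζ' ≠ 0)
    {n : ℕ} (hneg : (Finset.univ.filter fun φ : Φ.1 => (φ.1 s).im < 0).card = n)
    (hposc : (Finset.univ.filter fun φ : Φ.1 => 0 < (φ.1 s).im).card = n)
    (hx : ∀ i, x i = (ωb i : K)) (hγ : (γ₀ : K) = ζ' * s)
    (ha : ∀ i j, a i j = Algebra.trace ℚ K (ζ' * x i * IsCMField.complexConj K (s * x j)))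
    (hsign : (-1 : ℚ) ^ n * a.det ≤ 0) :
    ¬ ∀ φ : Φ.1, 0 < (φ.1 ζ').im := fun hpos =>
  absurd (neg_one_pow_mul_det_realPart_pos Φ ωb hζ' hs hs0 hζ'0 hpos hneg hposc hx hγ ha) (not_lt.mpr hsign)

end SignLaw

end Summit.HodgeConjecture.Ring2WeilCoverage.WeilGramSign

end
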